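import Mathlib.Algebra.Order.Interval.Basic
import Mathlib.Order.Interval.Basic
import Mathlib.Data.Rat.Cast.Order
import Mathlib.Data.NNRat.Defs
import Mathlib.Data.Real.Basic
import Literature.Analysis.ValidatedNumerics.IntervalEnclosure
import HarnessLib

/-!
# Interval calculus of a downfolded parameter box: declared inflation, hull under disjunctive
# trust (never average), meet under conjunctive trust, quotient by a positive scale, three-valued
# threshold comparison

Venture CertifiedManyBodySolver, cell `pub/hubbard-downfold` (HUMAN RULINGS D-0096/D-0098: stage S1 =
DOWNFOLDING FRONT END = ROUTER of the material oracle), seat hubbard-downfold-mod-1; namespaces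
`NonemptyInterval` (deliberate dot-notation extensions of Mathlib's interval type, as in
`Literature.Analysis.ValidatedNumerics.IntervalEnclosure`) and
`Summit.Ventures.CertifiedManyBodySolver.Downfold`. Everything here is PROVED (Mathlib + the tree's
`IntervalEnclosure`). WHAT THIS IS NOT: a certified statement about any material — S1 is SYSTEMATIC;
a parameter box is a modelling claim with provenance, never a number; this file only fixes which
OPERATIONS on such boxes are sound under which trust assumption.

A material with fixed composition is mapped by S1 to an effective lattice model whose couplings
`(t, t', t'', U, J, …)` form a PARAMETER BOX: per coordinate a closed interval with rational end
points plus a declared inflation radius (the named systematic error terms, summed) and a grade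
(companion file `Downfold.ParameterBox`). The interval-level rules:

* §1 `NonemptyInterval.inflate I r` (`r : ℚ≥0`) = `[a - r, b + r]`: `le_inflate`;
  `mem_inflate_of_abs_sub_le` — `y ∈ I`, `|x - y| ≤ r` ⇒ `x ∈ I.inflate r` (a DECLARED reduction /
  method error is carried as explicit inflation, e.g. three-band → one-band); `inflate_inflate`
  (errors of consecutive pipeline stages add); inclusion isotonicity.
* §2 HULL under DISJUNCTIVE trust: `mem_ratCast_sup_of_or` — if at least one of two sources
  encloses the value, Mathlib's hull `I ⊔ J` does ("disagreement ⇒ inflation"); the negative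
  statement `exists_midAvg_not_mem` — the end-point AVERAGE is not an enclosure rule under the same
  assumption ("never a silent average"). `meet?` (intersection) is licensed only under CONJUNCTIVE
  trust (both sources enclose, e.g. two certified rows): `mem_meet?`; then it cannot fail,
  `meet?_ne_none` (a `none` refutes the conjunction).
* §3 `invPos`, `divPos I T` = `I / T` for a scale interval with `0 < T.fst`: `div_mem_divPos`,
  `divPos_mono`, `divPos_fst_nonneg` — the dimensionless SHAPE coordinates `t'/t`, `U/t`, … by which
  a physical box (couplings in `eV`) meets the cells of the `t ≡ 1` model family; the scale `t`
  stays its own interval (transport theorems: `Downfold.HubbardScaleTransport`).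
* §4 `Downfold.cmpThreshold I θ ∈ {above, below, undetermined}` for the predicate `θ < x`:
  soundness (`lt_of_cmpThreshold_eq_above`, `le_of_cmpThreshold_eq_below`), HONESTY
  (`cmpThreshold_eq_undetermined_iff`: undetermined exactly when the box straddles `θ`, both
  answers being realised inside it) and refinement-stability (`cmpThreshold_eq_above_of_le`,
  `…_below_of_le`) — the primitive from which a router word "as a function of the box, including
  `undetermined (reason)`" is assembled (seat mod-2).

Design: rational end points and `ℚ≥0` radii (exact, decidable — what a pipeline emits as text);
enclosed quantities live in any linear ordered field `K` (`ratCast K`), `ℝ` downstream. Sources: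
Moore, *Interval Analysis* (1966) Ch. 2–3 (operations, inclusion property, hull/intersection);
Neumaier, *Interval Methods for Systems of Equations* (1990) §1.
-/

open Set

namespace NonemptyInterval

variable {K : Type*} [Field K] [LinearOrder K] [IsStrictOrderedRing K]

/-! ### §1 Inflation by a declared nonnegative radius -/

section Inflate

/-- **Inflation** of a rational interval by a nonnegative radius: `[a, b].inflate r = [a - r, b + r]`.
The device by which a DECLARED systematic error (method / reduction error of a pipeline stage) is
carried explicitly in a parameter box (Moore 1966, Ch. 2: `I + [-r, r]`; dot-notation extension of
Mathlib's `NonemptyInterval`). [cite: Moore1966, Ch. 2] -/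
def inflate (I : NonemptyInterval ℚ) (r : ℚ≥0) : NonemptyInterval ℚ :=
  ⟨(I.fst - r, I.snd + r), by
    have h := I.fst_le_snd
    have hr : (0 : ℚ) ≤ r := r.coe_nonneg
    simp only
    linarith⟩

/-- Left end point of the inflated interval. [folklore] -/
@[simp] theorem fst_inflate (I : NonemptyInterval ℚ) (r : ℚ≥0) :
    (I.inflate r).fst = I.fst - r := rfl

/-- Right end point of the inflated interval. [folklore] -/
@[simp] theorem snd_inflate (I : NonemptyInterval ℚ) (r : ℚ≥0) :
    (I.inflate r).snd = I.snd + r := rfl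

/-- Inflation only widens: `I ⊆ I.inflate r` (containment order of `NonemptyInterval`). [folklore] -/
theorem le_inflate (I : NonemptyInterval ℚ) (r : ℚ≥0) : I ≤ I.inflate r := by
  have hr : (0 : ℚ) ≤ r := r.coe_nonneg
  exact ⟨by simp only [fst_inflate]; linarith, by simp only [snd_inflate]; linarith⟩

/-- Inflating by `0` does nothing. [folklore] -/
@[simp] theorem inflate_zero (I : NonemptyInterval ℚ) : I.inflate 0 = I := by
  ext <;> simp

/-- **Errors of consecutive stages add**: inflating by `r` and then by `s` is inflating by `r + s`.
[folklore] -/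
theorem inflate_inflate (I : NonemptyInterval ℚ) (r s : ℚ≥0) :
    (I.inflate r).inflate s = I.inflate (r + s) := by
  ext <;> simp <;> ring

/-- Inflation is monotone in the interval (inclusion isotonicity). [cite: Moore1966, §3.1] -/
theorem inflate_mono_left {I J : NonemptyInterval ℚ} (h : I ≤ J) (r : ℚ≥0) :
    I.inflate r ≤ J.inflate r :=
  ⟨by simp only [fst_inflate]; linarith [h.1], by simp only [snd_inflate]; linarith [h.2]⟩

/-- Inflation is monotone in the radius. [folklore] -/
theorem inflate_mono_right (I : NonemptyInterval ℚ) {r s : ℚ≥0} (h : r ≤ s) :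
    I.inflate r ≤ I.inflate s := by
  have h' : (r : ℚ) ≤ s := NNRat.coe_le_coe.2 h
  exact ⟨by simp only [fst_inflate]; linarith, by simp only [snd_inflate]; linarith⟩

/-- A member of `I` is a member of every inflation of `I`. [folklore] -/
theorem mem_inflate_of_mem {I : NonemptyInterval ℚ} (r : ℚ≥0) {x : K} (hx : x ∈ I.ratCast K) :
    x ∈ (I.inflate r).ratCast K :=
  mem_ratCast_of_le (le_inflate I r) hx

/-- **Declared error ⇒ explicit inflation.** If `y ∈ I` and `x` is within `r` of `y` then
`x ∈ I.inflate r`: a reduction map with a declared error bound `r` (e.g. three-band → one-band) sends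
an enclosure of its input to the `r`-inflation as an enclosure of its output. [cite: Moore1966, Ch. 2] -/
theorem mem_inflate_of_abs_sub_le {I : NonemptyInterval ℚ} {r : ℚ≥0} {x y : K}
    (hy : y ∈ I.ratCast K) (hxy : |x - y| ≤ (r : ℚ)) : x ∈ (I.inflate r).ratCast K := by
  rw [mem_ratCast_iff] at hy ⊢
  rw [abs_le] at hxy
  simp only [fst_inflate, snd_inflate, Rat.cast_sub, Rat.cast_add]
  constructor <;> linarith [hxy.1, hxy.2, hy.1, hy.2]

end Inflate

/-! ### §2 Hull under disjunctive trust; intersection under conjunctive trust -/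

section Hull

/-- Casting commutes with the hull `⊔` of two intervals (end points `min` / `max`). [folklore] -/
theorem ratCast_sup (I J : NonemptyInterval ℚ) :
    (I ⊔ J).ratCast K = I.ratCast K ⊔ J.ratCast K := by
  ext
  · simp [fst_sup, Rat.cast_min]
  · simp [snd_sup, Rat.cast_max]

/-- **Hull rule (disjunctive trust).** If at least one of two intervals encloses `x`, their hull
`I ⊔ J` encloses `x` — the ONLY combination of two unverified sources licensed by the assumption
"at least one of them is right" (Moore 1966, Ch. 2, interval hull). [cite: Moore1966, Ch. 2] -/
theorem mem_ratCast_sup_of_or {I J : NonemptyInterval ℚ} {x : K}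
    (h : x ∈ I.ratCast K ∨ x ∈ J.ratCast K) : x ∈ (I ⊔ J).ratCast K := by
  rcases h with h | h
  · exact mem_ratCast_of_le le_sup_left h
  · exact mem_ratCast_of_le le_sup_right h

/-- The end-point **average** of two intervals, `[(a+c)/2, (b+d)/2]` — defined only to state that
it is NOT an enclosure rule (`exists_midAvg_not_mem`). [folklore] -/
def midAvg (I J : NonemptyInterval ℚ) : NonemptyInterval ℚ :=
  ⟨((I.fst + J.fst) / 2, (I.snd + J.snd) / 2), by
    have h₁ := I.fst_le_snd
    have h₂ := J.fst_le_snd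
    simp only
    linarith⟩

/-- **Never average.** There are intervals `I`, `J` and a point enclosed by one of them that the
end-point average does not enclose (`I = [0, 1]`, `J = [2, 3]`, `x = 0`, average `[1, 2]`): under
disjunctive trust averaging two disagreeing sources is unsound, only the hull is. [folklore] -/
theorem exists_midAvg_not_mem :
    ∃ I J : NonemptyInterval ℚ, ∃ x : ℚ, (x ∈ I ∨ x ∈ J) ∧ x ∉ midAvg I J := by
  refine ⟨⟨(0, 1), by norm_num⟩, ⟨(2, 3), by norm_num⟩, 0, Or.inl ⟨le_rfl, by norm_num⟩, ?_⟩
  rintro ⟨h, -⟩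
  norm_num [midAvg] at h

/-- **Intersection** of two rational intervals, `none` when they are disjoint. Licensed only under
CONJUNCTIVE trust (both are enclosures of the same number — e.g. two certified rows), see
`mem_meet?`. [cite: Moore1966, Ch. 2] -/
def meet? (I J : NonemptyInterval ℚ) : Option (NonemptyInterval ℚ) :=
  if h : max I.fst J.fst ≤ min I.snd J.snd then some ⟨(max I.fst J.fst, min I.snd J.snd), h⟩
  else none

/-- Intersection rule (conjunctive trust): a number enclosed by BOTH intervals is enclosed by their
intersection. [cite: Moore1966, Ch. 2] -/
theorem mem_meet? {I J M : NonemptyInterval ℚ} {x : K} (hI : x ∈ I.ratCast K)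
    (hJ : x ∈ J.ratCast K) (hM : I.meet? J = some M) : x ∈ M.ratCast K := by
  rw [mem_ratCast_iff] at hI hJ ⊢
  unfold meet? at hM
  split_ifs at hM with h
  simp only [Option.some.injEq] at hM
  subst hM
  simp only [Rat.cast_max, Rat.cast_min, max_le_iff, le_min_iff]
  exact ⟨⟨hI.1, hJ.1⟩, hI.2, hJ.2⟩

/-- Two genuine enclosures of the same number always meet: under conjunctive trust the intersection
never fails (so a `none` REFUTES the conjunction — at least one source was not an enclosure).
[folklore] -/
theorem meet?_ne_none {I J : NonemptyInterval ℚ} {x : K} (hI : x ∈ I.ratCast K)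
    (hJ : x ∈ J.ratCast K) : I.meet? J ≠ none := by
  rw [mem_ratCast_iff] at hI hJ
  unfold meet?
  split_ifs with h
  · exact Option.some_ne_none _
  · exfalso
    apply h
    have h1 : ((max I.fst J.fst : ℚ) : K) ≤ x := by
      rw [Rat.cast_max]; exact max_le hI.1 hJ.1
    have h2 : x ≤ ((min I.snd J.snd : ℚ) : K) := by
      rw [Rat.cast_min]; exact le_min hI.2 hJ.2
    exact_mod_cast h1.trans h2

end Hull

/-! ### §3 Shape coordinates: division by a positive scale interval -/

section DivPos

/-- The reciprocal interval `[d⁻¹, c⁻¹]` of a positive interval `[c, d]`, `0 < c`. [cite: Moore1966, Ch. 2] -/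
def invPos (T : NonemptyInterval ℚ) (hT : 0 < T.fst) : NonemptyInterval ℚ :=
  ⟨(T.snd⁻¹, T.fst⁻¹), inv_anti₀ hT T.fst_le_snd⟩

/-- Inclusion property of `invPos`. [cite: Moore1966, Theorem 3.1] -/
theorem inv_mem_invPos {T : NonemptyInterval ℚ} (hT : 0 < T.fst) {s : K} (hs : s ∈ T.ratCast K) :
    s⁻¹ ∈ (T.invPos hT).ratCast K := by
  rw [mem_ratCast_iff] at hs ⊢
  have hT' : (0 : K) < T.fst := by exact_mod_cast hT
  have hs0 : 0 < s := hT'.trans_le hs.1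
  simp only [invPos, Rat.cast_inv]
  exact ⟨inv_anti₀ hs0 hs.2, inv_anti₀ hT' hs.1⟩

/-- **Quotient by a positive scale**: `I.divPos T = I · [d⁻¹, c⁻¹]` for `T = [c, d]`, `0 < c` (Moore
product with the reciprocal interval). With `T` the nearest-neighbour hopping `t` of a downfolded
box and `I` another coupling, this is the dimensionless SHAPE coordinate (`t'/t`, `U/t`, …) by
which the box is compared with the cells of the `t ≡ 1` model family. [cite: Moore1966, Ch. 2] -/
def divPos (I T : NonemptyInterval ℚ) (hT : 0 < T.fst) : NonemptyInterval ℚ :=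
  I.mooreMul (T.invPos hT)

/-- Inclusion property of `divPos`: `x ∈ I`, `s ∈ T` ⇒ `x / s ∈ I.divPos T`. [cite: Moore1966, Theorem 3.1] -/
theorem div_mem_divPos {I T : NonemptyInterval ℚ} (hT : 0 < T.fst) {x s : K}
    (hx : x ∈ I.ratCast K) (hs : s ∈ T.ratCast K) : x / s ∈ (I.divPos T hT).ratCast K := by
  rw [divPos, ratCast_mooreMul, div_eq_mul_inv]
  exact mul_mem_mooreMul hx (inv_mem_invPos hT hs)

/-- `divPos` is inclusion-isotone in both arguments (a wider box has a wider shape). [cite: Moore1966, §3.1] -/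
theorem divPos_mono {I I' T T' : NonemptyInterval ℚ} (hI : I ≤ I') (hTT' : T ≤ T')
    (hT : 0 < T.fst) (hT' : 0 < T'.fst) : I.divPos T hT ≤ I'.divPos T' hT' := by
  refine mooreMul_le_mooreMul hI ⟨?_, ?_⟩
  · simp only [invPos]
    exact inv_anti₀ (hT.trans_le T.fst_le_snd) hTT'.2
  · simp only [invPos]
    exact inv_anti₀ hT' hTT'.1

/-- A quotient of a nonnegative interval by a positive scale is nonnegative (e.g. `U/t ≥ 0`).
[folklore] -/
theorem divPos_fst_nonneg {I T : NonemptyInterval ℚ} (hT : 0 < T.fst) (hI : 0 ≤ I.fst) :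
    0 ≤ (I.divPos T hT).fst := by
  have h1 : 0 ≤ I.snd := hI.trans I.fst_le_snd
  have h2 : (0 : ℚ) ≤ T.snd⁻¹ := inv_nonneg.2 (hT.le.trans T.fst_le_snd)
  have h3 : (0 : ℚ) ≤ T.fst⁻¹ := inv_nonneg.2 hT.le
  simp only [divPos, invPos, fst_mooreMul, le_min_iff]
  exact ⟨⟨mul_nonneg hI h2, mul_nonneg hI h3⟩, mul_nonneg h1 h2, mul_nonneg h1 h3⟩

end DivPos

end NonemptyInterval

namespace Summit.Ventures.CertifiedManyBodySolver.Downfold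

open NonemptyInterval

variable {K : Type*} [Field K] [LinearOrder K] [IsStrictOrderedRing K]
/-! ### §4 Three-valued comparison of a box coordinate with a threshold -/


/-- The three answers of a box-level comparison: the predicate holds on the whole box, fails on
the whole box, or the box straddles the threshold. [folklore] -/
inductive Trilean
  | above
  | below
  | undetermined
  deriving DecidableEq, Repr

/-- **Box-level comparison with a threshold** `θ` for the strict predicate `θ < x`: `above` if
`θ < I.fst`, `below` if `I.snd ≤ θ`, otherwise `undetermined` (the box straddles `θ`). [folklore] -/
def cmpThreshold (I : NonemptyInterval ℚ) (θ : ℚ) : Trilean :=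
  if θ < I.fst then .above else if I.snd ≤ θ then .below else .undetermined

/-- Soundness of `above`: every point of the box exceeds the threshold. [folklore] -/
theorem lt_of_cmpThreshold_eq_above {I : NonemptyInterval ℚ} {θ : ℚ}
    (h : cmpThreshold I θ = .above) {x : K} (hx : x ∈ I.ratCast K) : (θ : K) < x := by
  unfold cmpThreshold at h
  split_ifs at h with h1
  rw [mem_ratCast_iff] at hx
  exact lt_of_lt_of_le (by exact_mod_cast h1) hx.1

/-- Soundness of `below`: no point of the box exceeds the threshold. [folklore] -/
theorem le_of_cmpThreshold_eq_below {I : NonemptyInterval ℚ} {θ : ℚ}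
    (h : cmpThreshold I θ = .below) {x : K} (hx : x ∈ I.ratCast K) : x ≤ (θ : K) := by
  unfold cmpThreshold at h
  split_ifs at h with h1 h2
  rw [mem_ratCast_iff] at hx
  exact hx.2.trans (by exact_mod_cast h2)

/-- **Honesty of `undetermined`**: the answer is `undetermined` exactly when the box straddles the
threshold, `I.fst ≤ θ < I.snd` — i.e. both answers are realised by points of the box, so no sound
procedure could have decided from the box alone. [folklore] -/
theorem cmpThreshold_eq_undetermined_iff {I : NonemptyInterval ℚ} {θ : ℚ} :
    cmpThreshold I θ = .undetermined ↔ I.fst ≤ θ ∧ θ < I.snd := by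
  unfold cmpThreshold
  split_ifs with h1 h2
  · simp only [false_iff, not_and, not_lt]
    exact fun h => absurd h1 (not_lt.2 h)
  · simp only [false_iff, not_and, not_lt]
    exact fun _ => h2
  · simp only [true_iff]
    exact ⟨not_lt.1 h1, not_le.1 h2⟩

/-- When the answer is `undetermined`, the box indeed contains a point above and a point not above
the threshold (its two end points). [folklore] -/
theorem exists_mem_of_cmpThreshold_eq_undetermined {I : NonemptyInterval ℚ} {θ : ℚ}
    (h : cmpThreshold I θ = .undetermined) :
    (∃ x ∈ I, θ < x) ∧ ∃ x ∈ I, x ≤ θ := by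
  rw [cmpThreshold_eq_undetermined_iff] at h
  exact ⟨⟨I.snd, ⟨I.fst_le_snd, le_rfl⟩, h.2⟩, ⟨I.fst, ⟨le_rfl, I.fst_le_snd⟩, h.1⟩⟩

/-- **Refinement can only resolve**: if a wider box answers `above`, every sub-box answers `above`.
[folklore] -/
theorem cmpThreshold_eq_above_of_le {I J : NonemptyInterval ℚ} (hIJ : I ≤ J) {θ : ℚ}
    (h : cmpThreshold J θ = .above) : cmpThreshold I θ = .above := by
  unfold cmpThreshold at h ⊢
  split_ifs at h with h1
  rw [if_pos (lt_of_lt_of_le h1 hIJ.1)]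

/-- Refinement can only resolve: if a wider box answers `below`, every sub-box answers `below`.
[folklore] -/
theorem cmpThreshold_eq_below_of_le {I J : NonemptyInterval ℚ} (hIJ : I ≤ J) {θ : ℚ}
    (h : cmpThreshold J θ = .below) : cmpThreshold I θ = .below := by
  unfold cmpThreshold at h ⊢
  split_ifs at h with h1 h2
  have h3 : I.snd ≤ θ := hIJ.2.trans h2
  rw [if_neg (not_lt.2 ((I.fst_le_snd.trans h3))), if_pos h3]


end Summit.Ventures.CertifiedManyBodySolver.Downfold

/-! ### §5 (append) FLOOR as a minimum half-width; affine images (ROUTER v0.5 §4.3 BOX-WIDTH ALGEBRA) -/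

namespace NonemptyInterval

variable {K : Type*} [Field K] [LinearOrder K] [IsStrictOrderedRing K]

/-- Midpoint `(a + b)/2` of a rational interval `[a, b]`. [folklore] -/
def midpoint (I : NonemptyInterval ℚ) : ℚ := (I.fst + I.snd) / 2

/-- Half-width `(b - a)/2` of a rational interval `[a, b]`. [folklore] -/
def halfWidth (I : NonemptyInterval ℚ) : ℚ := (I.snd - I.fst) / 2

/-- The half-width is nonnegative. [folklore] -/
theorem halfWidth_nonneg (I : NonemptyInterval ℚ) : 0 ≤ I.halfWidth := by unfold halfWidth; linarith [I.fst_le_snd]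

/-- **FLOOR as a MINIMUM half-width** (ROUTER v0.5 §4.3 (2)): `I` itself when its half-width is at
least `F`, else `midpoint ± F`; realised as inflation by `max 0 (F - halfWidth)` (so `le_floorTo`); a
policy on CLAIMED precision, deliberately not inclusion-isotone. [folklore] -/
def floorTo (I : NonemptyInterval ℚ) (F : ℚ≥0) : NonemptyInterval ℚ :=
  I.inflate ⟨max 0 ((F : ℚ) - I.halfWidth), le_max_left _ _⟩

/-- Flooring only widens: `I ⊆ I.floorTo F`. [folklore] -/
theorem le_floorTo (I : NonemptyInterval ℚ) (F : ℚ≥0) : I ≤ I.floorTo F := le_inflate _ _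

/-- End points of the floored interval. [folklore] -/
theorem floorTo_ends (I : NonemptyInterval ℚ) (F : ℚ≥0) : (I.floorTo F).fst = I.fst - max 0 ((F : ℚ)
    - I.halfWidth) ∧ (I.floorTo F).snd = I.snd + max 0 ((F : ℚ) - I.halfWidth) := ⟨rfl, rfl⟩

/-- If the hull is already at least as wide as the floor, flooring does nothing. [folklore] -/
theorem floorTo_eq_self_of_le {I : NonemptyInterval ℚ} {F : ℚ≥0} (h : (F : ℚ) ≤ I.halfWidth) :
    I.floorTo F = I := by
  have h0 : max 0 ((F : ℚ) - I.halfWidth) = 0 := max_eq_left (by linarith)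
  ext
  · show I.fst - max 0 ((F : ℚ) - I.halfWidth) = I.fst
    rw [h0, sub_zero]
  · show I.snd + max 0 ((F : ℚ) - I.halfWidth) = I.snd
    rw [h0, add_zero]

/-- If the hull is narrower than the floor, the floored interval is `midpoint ± F`. [folklore] -/
theorem floorTo_eq_of_le {I : NonemptyInterval ℚ} {F : ℚ≥0} (h : I.halfWidth ≤ (F : ℚ)) :
    (I.floorTo F).fst = I.midpoint - F ∧ (I.floorTo F).snd = I.midpoint + F := by
  have h0 : max 0 ((F : ℚ) - I.halfWidth) = F - I.halfWidth := max_eq_right (by linarith)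
  rw [(floorTo_ends I F).1, (floorTo_ends I F).2, h0]
  unfold midpoint halfWidth
  constructor <;> ring

/-- **Affine image** `a + b·I` (exact range of `x ↦ a + b x`): filling from hole doping `n = 1 - x`,
particle–hole image `n ↦ 2 - n`, `t' ↦ -t'`, unit changes, `W = 8t`. [folklore] -/
def affine (I : NonemptyInterval ℚ) (a b : ℚ) : NonemptyInterval ℚ :=
  ⟨(a + min (b * I.fst) (b * I.snd), a + max (b * I.fst) (b * I.snd)), by
    have h : min (b * I.fst) (b * I.snd) ≤ max (b * I.fst) (b * I.snd) := min_le_max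
    simp only; linarith⟩

/-- Inclusion property of the affine image: `x ∈ I ⇒ a + b x ∈ I.affine a b`. [folklore] -/
theorem mem_affine {I : NonemptyInterval ℚ} (a b : ℚ) {x : K} (hx : x ∈ I.ratCast K) :
    (a : K) + b * x ∈ (I.affine a b).ratCast K := by
  rw [mem_ratCast_iff] at hx ⊢
  simp only [affine, Rat.cast_add, Rat.cast_min, Rat.cast_max, Rat.cast_mul]
  rcases le_total 0 (b : K) with hb | hb
  · exact ⟨by linarith [min_le_left ((b : K) * I.fst) (b * I.snd), mul_le_mul_of_nonneg_left hx.1 hb],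
      by linarith [le_max_right ((b : K) * I.fst) (b * I.snd), mul_le_mul_of_nonneg_left hx.2 hb]⟩
  · exact ⟨by linarith [min_le_right ((b : K) * I.fst) (b * I.snd), mul_le_mul_of_nonpos_left hx.2 hb],
      by linarith [le_max_left ((b : K) * I.fst) (b * I.snd), mul_le_mul_of_nonpos_left hx.1 hb]⟩

end NonemptyInterval
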